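import Mathlib
import Summits.Ventures.HodgeRepro.Tier4.Line4.DichotomyRow
import Summits.Ventures.HodgeRepro.Tier4.Line1.DefinedContentOfData

/-!
# Tier4/Line4/DichotomyLin — C-L4-DICH-LIN: the LINEAR form of (S-DICH) — a rational point that is not a transporter is
LINEARLY regular

Blind re-derivation cell `pub-hodge-repro`, Tier 4 «prove the step» (README §9–§10), seat t4-L1-p1 (prover, LINE L1,
gen 4; plan-4 g5's RE-TARGET S15470 on the DICH/REGCOORD seam, crit-2 Entry 286).  Tree path
`lean/Summits/Ventures/HodgeRepro/Tier4/Line4/DichotomyLin.lean`.  Mathlib-level; no literature.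

WHAT IS PROVED (every declaration sorry-free, axioms `[propext, Classical.choice, Quot.sound]`).
* `matrix_eq_scalar_of_three_lines (M : M4 k) (hMΩ) (h0) (h1) (hf) : ∃ c e, M = c • 1 + e • adMat k W.Ω` — L1-p3's
  `mat_eq_scalar_of_three_lines` (ThreeLines) for an arbitrary adelic MATRIX `M` commuting with `Ω`, `P 0`, `P 1` and
  the rank-2 `Ω`-stable `f` (its proof uses the unitary `t` only through these four commutation facts; the proof is
  L1-p3's verbatim, with `M` a variable; `range_le_span_pair`, `adMat_mulVec_comp`, `mulVec_adMat_mem_span` by name).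
* `isLinRegular_of_not_transporter_core {d} (hΩ) (hd) (hPr) (hQr) (γ) (h) : IsLinRegular W γ` — the engine of
  Dichotomy p707809 in the linear form: `Y γ = γ Y′` gives `Y = u Y′ u⁻¹`, so `Y` commutes with the transported
  projectors `conjProj u j`; if some transported line is neither `P`-line, three lines make `Y = x + yΩ`, and then
  `Y′ = u⁻¹ Y u = x + yΩ` (`u` commutes with `Ω`); otherwise `γ⁻¹ T γ = T′` against `h` (p707809's lemmas by name).
* **`isLinRegular_of_not_transporter_row (hg : IsGenuineRow W) (γ : rationalPoints W)
  (h : (torusT W).map (MulAut.conj ((γ : GA W))⁻¹).toMonoidHom ≠ torusT' W) : IsLinRegular W γ`** — (S-DICH) in the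
  LINEAR form of record (REGCOORD's input); `isRegularRational_of_not_transporter_row'` — the rational form as a
  corollary through L1-p3's `isRegularRational_of_isLinRegular` (support, by name).

Nothing here says anything about the status of the Hodge conjecture for CM abelian varieties, which is NOT proved
(HC_CM is NOT proved by anyone in this repository).
-/

set_option autoImplicit false
noncomputable section
namespace Summit.Ventures.HodgeRepro.Tier4.Line4
open Summit.Ventures.HodgeRepro.Tier4 Summit.Ventures.HodgeRepro.Tier4.Common Summit.Ventures.HodgeRepro.Tier4.Line1
  NumberField Matrix

section DichotomyLin

variable {k : Type} [Field k] [NumberField k] (W : PlaneData k)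

/-- **three lines force a scalar, linear form** (L1-p3's `mat_eq_scalar_of_three_lines` for a matrix `M`): an adelic
matrix `M` commuting with `Ω`, with the projectors `P 0`, `P 1` and with a rank-2 `Ω`-stable projector `f` whose image
contains a `z` with `P 0 z ≠ 0 ≠ P 1 z` is an `E′`-scalar `c·1 + e·Ω`. -/
theorem matrix_eq_scalar_of_three_lines {d : k} (hΩ : W.Ω * W.Ω = -(d • (1 : Matrix (Fin 4) (Fin 4) k)))
    (hd : ¬ IsSquare (-d)) (hP0 : (W.P 0).rank = 2) (hP1 : (W.P 1).rank = 2)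
    {f : Matrix (Fin 4) (Fin 4) k} (hfΩ : f * W.Ω = W.Ω * f) (hfr : f.rank = 2)
    {z : Fin 4 → k} (hzf : z ∈ LinearMap.range f.mulVecLin)
    (hx : W.P 0 *ᵥ z ≠ 0) (hy : W.P 1 *ᵥ z ≠ 0)
    (M : M4 k) (htΩ : M * adMat k W.Ω = adMat k W.Ω * M)
    (ht0 : M * adMat k (W.P 0) = adMat k (W.P 0) * M)
    (ht1 : M * adMat k (W.P 1) = adMat k (W.P 1) * M)
    (htf : M * adMat k f = adMat k f * M) :
    ∃ c e : Ad k, M = c • (1 : M4 k) + e • adMat k W.Ω := by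
  set ι := algebraMap k (Ad k) with hι
  have hz : z ≠ 0 := by
    intro h
    apply hx
    rw [h, mulVec_zero]
  have hspanf := range_le_span_pair W hΩ hd hfΩ hfr hz hzf
  have hxP : W.P 0 *ᵥ z ∈ LinearMap.range (W.P 0).mulVecLin := ⟨z, rfl⟩
  have hyP : W.P 1 *ᵥ z ∈ LinearMap.range (W.P 1).mulVecLin := ⟨z, rfl⟩
  have hspan0 := range_le_span_pair W hΩ hd (W.P_comm 0) hP0 hx hxP
  have hspan1 := range_le_span_pair W hΩ hd (W.P_comm 1) hP1 hy hyP
  -- step 1: `t z ∈ span {z, Ωz}` adelically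
  obtain ⟨z', hz'⟩ := hzf
  have hz'' : adMat k f *ᵥ (ι ∘ z') = ι ∘ z := by
    rw [adMat_mulVec_comp, ← hz']
    rfl
  have h1' : M *ᵥ (ι ∘ z) = adMat k f *ᵥ (M *ᵥ (ι ∘ z')) := by
    rw [← hz'', mulVec_mulVec, htf, ← mulVec_mulVec]
  have h1 : M *ᵥ (ι ∘ z) ∈ Submodule.span (Ad k) {ι ∘ z, ι ∘ (W.Ω *ᵥ z)} := by
    rw [h1']
    exact mulVec_adMat_mem_span W hspanf _
  obtain ⟨c, e, hce⟩ := Submodule.mem_span_pair.mp h1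
  refine ⟨c, e, ?_⟩
  -- the difference `N` kills `z`, hence `x, Ωx, y, Ωy`, hence everything
  set N : M4 k := M - (c • (1 : M4 k) + e • adMat k W.Ω) with hN
  have hcomm : ∀ A : Matrix (Fin 4) (Fin 4) k, M * adMat k A = adMat k A * M → A * W.Ω = W.Ω * A →
      N * adMat k A = adMat k A * N := by
    intro A hMA hAΩ
    have hΩA : adMat k W.Ω * adMat k A = adMat k A * adMat k W.Ω := by
      rw [← adMat_mul, ← hAΩ, adMat_mul]
    rw [hN, sub_mul, mul_sub, add_mul, mul_add, smul_mul_assoc, mul_smul_comm, one_mul, mul_one,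
      smul_mul_assoc, mul_smul_comm, hMA, hΩA]
  have hcommΩ : N * adMat k W.Ω = adMat k W.Ω * N := hcomm W.Ω htΩ rfl
  have hNz : N *ᵥ (ι ∘ z) = 0 := by
    rw [hN, sub_mulVec, add_mulVec, smul_mulVec, one_mulVec, smul_mulVec, adMat_mulVec_comp, ← hce,
      sub_self]
  have hkill : ∀ (A : Matrix (Fin 4) (Fin 4) k), N * adMat k A = adMat k A * N →
      N *ᵥ (ι ∘ (A *ᵥ z)) = 0 := by
    intro A hNA
    rw [← adMat_mulVec_comp, mulVec_mulVec, hNA, ← mulVec_mulVec, hNz, mulVec_zero]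
  have hkillΩ : ∀ v : Fin 4 → k, N *ᵥ (ι ∘ v) = 0 → N *ᵥ (ι ∘ (W.Ω *ᵥ v)) = 0 := by
    intro v hv
    rw [← adMat_mulVec_comp, mulVec_mulVec, hcommΩ, ← mulVec_mulVec, hv, mulVec_zero]
  have hNx := hkill (W.P 0) (hcomm _ ht0 (W.P_comm 0))
  have hNy := hkill (W.P 1) (hcomm _ ht1 (W.P_comm 1))
  have hNΩx := hkillΩ _ hNx
  have hNΩy := hkillΩ _ hNy
  -- `N * adMat (P i) = 0`
  have hNP : ∀ (i : Fin 2) (v : Fin 4 → k),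
      N *ᵥ (ι ∘ v) = 0 → N *ᵥ (ι ∘ (W.Ω *ᵥ v)) = 0 →
      LinearMap.range (W.P i).mulVecLin ≤ Submodule.span k {v, W.Ω *ᵥ v} →
      N * adMat k (W.P i) = 0 := by
    intro i v hv hΩv hsp
    have key : ∀ w : Fin 4 → Ad k, (N * adMat k (W.P i)) *ᵥ w = 0 := by
      intro w
      rw [← mulVec_mulVec]
      obtain ⟨a, b, hab⟩ := Submodule.mem_span_pair.mp (mulVec_adMat_mem_span W hsp w)
      rw [← hab, mulVec_add, mulVec_smul, mulVec_smul, hv, hΩv, smul_zero, smul_zero, add_zero]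
    ext i' j
    have h := congrFun (key (Pi.single j 1)) i'
    rw [mulVec_single_one] at h
    simpa using h
  have hNP0 := hNP 0 _ hNx hNΩx hspan0
  have hNP1 := hNP 1 _ hNy hNΩy hspan1
  have hN0 : N = 0 := by
    have h := W.P_sum
    calc N = N * adMat k (W.P 0 + W.P 1) := by rw [h, adMat_one, mul_one]
      _ = N * adMat k (W.P 0) + N * adMat k (W.P 1) := by rw [adMat_add, mul_add]
      _ = 0 := by rw [hNP0, hNP1, add_zero]
  rw [hN] at hN0
  exact sub_eq_zero.mp hN0


/-- **(S-DICH), linear form, the engine on its three clauses**: `Ω² = −d` with `−d` a non-square and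
`rank (P i) = rank (Q i) = 2`; then a rational point that is not a transporter is LINEARLY regular. -/
theorem isLinRegular_of_not_transporter_core {d : k} (hΩ : W.Ω * W.Ω = -(d • (1 : Matrix (Fin 4) (Fin 4) k)))
    (hd : ¬ IsSquare (-d)) (hPr : ∀ i, (W.P i).rank = 2) (hQr : ∀ i, (W.Q i).rank = 2) (γ : rationalPoints W)
    (h : (torusT W).map (MulAut.conj ((γ : GA W))⁻¹).toMonoidHom ≠ torusT' W) :
    IsLinRegular W γ := by
  obtain ⟨u, hu, hu'⟩ := exists_rational_gl W γ
  have hcomm := rational_mat_comm_Ω W γ u hu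
  intro Y Y' hYΩ hYP hY'Ω hY'Q hYγ
  have hinv1 : adMat k ((u⁻¹ : GL (Fin 4) k) : Matrix (Fin 4) (Fin 4) k) *
      adMat k (u : Matrix (Fin 4) (Fin 4) k) = 1 := by
    rw [← adMat_mul, Units.inv_mul, adMat_one]
  have hinv2 : adMat k (u : Matrix (Fin 4) (Fin 4) k) *
      adMat k ((u⁻¹ : GL (Fin 4) k) : Matrix (Fin 4) (Fin 4) k) = 1 := by
    rw [← adMat_mul, Units.mul_inv, adMat_one]
  set U := adMat k (u : Matrix (Fin 4) (Fin 4) k) with hU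
  set V := adMat k ((u⁻¹ : GL (Fin 4) k) : Matrix (Fin 4) (Fin 4) k) with hV
  -- `Y = u Y′ u⁻¹`
  have hYeq : Y = U * Y' * V := by
    have h1 : Y * U = U * Y' := by
      rw [hu] at hYγ
      exact hYγ
    calc Y = Y * (U * V) := by rw [hinv2, mul_one]
      _ = (Y * U) * V := by rw [mul_assoc]
      _ = U * Y' * V := by rw [h1]
  -- `Y′ = u⁻¹ Y u`
  have hY'eq : Y' = V * Y * U := by
    rw [hYeq]
    calc Y' = (V * U) * Y' * (V * U) := by rw [hinv1, one_mul, mul_one]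
      _ = V * (U * Y' * V) * U := by simp only [mul_assoc]
  -- `Y` commutes with the transported projectors
  have hRcomm : ∀ j : Fin 2, Y * adMat k (conjProj W u j) = adMat k (conjProj W u j) * Y := by
    intro j
    have hQ : Y' * adMat k (W.Q j) = adMat k (W.Q j) * Y' := hY'Q j
    unfold conjProj
    rw [adMat_mul, adMat_mul, hYeq]
    set X := Y'
    set Z := adMat k (W.Q j)
    calc U * X * V * (U * Z * V) = U * X * (V * U) * Z * V := by simp only [mul_assoc]
      _ = U * (X * Z) * V := by rw [hinv1, mul_one]; simp only [mul_assoc]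
      _ = U * (Z * X) * V := by rw [hQ]
      _ = U * Z * (V * U) * X * V := by rw [hinv1, mul_one]; simp only [mul_assoc]
      _ = U * Z * V * (U * X * V) := by simp only [mul_assoc]
  have hRΩ : ∀ j, conjProj W u j * W.Ω = W.Ω * conjProj W u j := conjProj_comm_Ω W u hcomm
  have hRr : ∀ j, (conjProj W u j).rank = 2 := fun j => by rw [conjProj_rank]; exact hQr j
  -- `u⁻¹ Ω u = Ω`
  have hΩconj : V * adMat k W.Ω * U = adMat k W.Ω := by
    have hΩU : adMat k W.Ω * U = U * adMat k W.Ω := by rw [hU, ← adMat_mul, ← adMat_mul, hcomm]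
    calc V * adMat k W.Ω * U = V * (U * adMat k W.Ω) := by rw [mul_assoc, hΩU]
      _ = adMat k W.Ω := by rw [← mul_assoc, hinv1, one_mul]
  -- a scalar `Y` settles the claim: `Y′ = u⁻¹ Y u` is the same scalar
  have hscalar : ∀ j : Fin 2, (∃ z ∈ LinearMap.range (conjProj W u j).mulVecLin,
      W.P 0 *ᵥ z ≠ 0 ∧ W.P 1 *ᵥ z ≠ 0) →
      ∃ x y : Ad k, Y = x • (1 : M4 k) + y • adMat k W.Ω ∧ Y' = x • (1 : M4 k) + y • adMat k W.Ω := by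
    intro j hz
    obtain ⟨z, hzR, hx, hy⟩ := hz
    obtain ⟨c, e, hce⟩ := matrix_eq_scalar_of_three_lines W hΩ hd (hPr 0) (hPr 1) (hRΩ j) (hRr j) hzR hx hy Y
      hYΩ (hYP 0) (hYP 1) (hRcomm j)
    refine ⟨c, e, hce, ?_⟩
    rw [hY'eq, hce]
    calc V * (c • (1 : M4 k) + e • adMat k W.Ω) * U
        = c • (V * U) + e • (V * adMat k W.Ω * U) := by
          simp only [mul_add, add_mul, mul_smul_comm, smul_mul_assoc, mul_one]
      _ = c • (1 : M4 k) + e • adMat k W.Ω := by rw [hinv1, hΩconj]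
  by_cases hz0 : ∃ z ∈ LinearMap.range (conjProj W u 0).mulVecLin, W.P 0 *ᵥ z ≠ 0 ∧ W.P 1 *ᵥ z ≠ 0
  · exact hscalar 0 hz0
  by_cases hz1 : ∃ z ∈ LinearMap.range (conjProj W u 1).mulVecLin, W.P 0 *ᵥ z ≠ 0 ∧ W.P 1 *ᵥ z ≠ 0
  · exact hscalar 1 hz1
  -- both transported lines are `P`-lines: the transporter identity contradicts `h`
  have hline : ∀ j : Fin 2, LinearMap.range (conjProj W u j).mulVecLin = LinearMap.range (W.P 0).mulVecLin ∨
      LinearMap.range (conjProj W u j).mulVecLin = LinearMap.range (W.P 1).mulVecLin := by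
    intro j
    by_contra hcon
    have hcon' := not_or.1 hcon
    have hz := exists_mem_range_components_ne_zero W hΩ hd (hPr 0) (hPr 1) (hRΩ j) (hRr j) hcon'.1 hcon'.2
    rcases j with ⟨j, hj⟩
    interval_cases j
    · exact hz0 hz
    · exact hz1 hz
  exfalso
  apply h
  have hne : LinearMap.range (conjProj W u 0).mulVecLin ≠ LinearMap.range (conjProj W u 1).mulVecLin :=
    range_ne_range_compl (conjProj_idem W u 1) (conjProj_sum W u) (ne_zero_of_rank_eq_two (hRr 1))
  have hP10 : W.P 1 + W.P 0 = 1 := by rw [add_comm]; exact W.P_sum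
  have hR10' : conjProj W u 1 * conjProj W u 0 = 0 := by
    have hsum := conjProj_sum W u
    have : conjProj W u 0 = 1 - conjProj W u 1 := eq_sub_of_add_eq hsum
    rw [this, mul_sub, mul_one, conjProj_idem, sub_self]
  rcases hline 0 with h00 | h01 <;> rcases hline 1 with h10 | h11
  · exact absurd (h00.trans h10.symm) hne
  · have e0 : conjProj W u 0 = W.P 0 :=
      eq_of_range_eq_of_range_compl_eq (conjProj_idem W u 0) (conjProj_mul_zero_one W u) W.P_sum h00 h11
    have e1 : conjProj W u 1 = W.P 1 :=
      eq_of_range_eq_of_range_compl_eq (conjProj_idem W u 1) hR10' hP10 h11 h00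
    exact map_torusT_eq_torusT'_of_conj W γ u hu hu' (i := 0) (i' := 1) (by decide)
      (Q_eq_of_conjProj_eq W u e0) (Q_eq_of_conjProj_eq W u e1)
  · have e0 : conjProj W u 0 = W.P 1 :=
      eq_of_range_eq_of_range_compl_eq (conjProj_idem W u 0) (conjProj_mul_zero_one W u) hP10 h01 h10
    have e1 : conjProj W u 1 = W.P 0 :=
      eq_of_range_eq_of_range_compl_eq (conjProj_idem W u 1) hR10' W.P_sum h10 h01
    exact map_torusT_eq_torusT'_of_conj W γ u hu hu' (i := 1) (i' := 0) (by decide)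
      (Q_eq_of_conjProj_eq W u e0) (Q_eq_of_conjProj_eq W u e1)
  · exact absurd (h01.trans h11.symm) hne

/-- **C-L4-DICH-LIN — (S-DICH) in the LINEAR form of record** (plan-4 S15470): under the row genericity predicate, a
rational point that is not a transporter is linearly regular (REGCOORD's input). -/
theorem isLinRegular_of_not_transporter_row (hg : IsGenuineRow W) (γ : rationalPoints W)
    (h : (torusT W).map (MulAut.conj ((γ : GA W))⁻¹).toMonoidHom ≠ torusT' W) :
    IsLinRegular W γ := by
  obtain ⟨⟨d, hΩ, hd⟩, -, -, -, hPr, hQr⟩ := hg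
  exact isLinRegular_of_not_transporter_core W hΩ hd hPr hQr γ h

/-- the rational form as a corollary of the linear form (L1-p3's `isRegularRational_of_isLinRegular`, support). -/
theorem isRegularRational_of_not_transporter_row' (hg : IsGenuineRow W) (γ : rationalPoints W)
    (h : (torusT W).map (MulAut.conj ((γ : GA W))⁻¹).toMonoidHom ≠ torusT' W) :
    IsRegularRational W γ :=
  isRegularRational_of_isLinRegular W γ (isLinRegular_of_not_transporter_row W hg γ h)

end DichotomyLin

end Summit.Ventures.HodgeRepro.Tier4.Line4

end
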